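import Literature.Probability.Process.GaussianLinearSpace
import Literature.Analysis.InnerProduct.AntitoneProjection
import HarnessLib

/-!
# Germ σ-algebras of a Gaussian linear process: `L²` of the germ is spanned by germ characters

Let `X : V →ₗ[ℝ] (Ω → ℝ)` be a centred Gaussian linear process (`IsGaussianLinearProcess`) and
`I 0 ≥ I 1 ≥ ⋯` an antitone sequence of submodules of test vectors — in Rozanov's setting `V` is a
space of test functions and `I n = {u : supp u ⊆ S^{εₙ}}` for neighbourhoods shrinking to a set `S`.
Two "germ" objects are attached to the sequence:

* the germ σ-algebra `⨅ n, σ(X v : v ∈ I n)` (Rozanov's `𝒜₊(S) = ⋂_ε 𝒜(S^ε)`, Ch. 2 §1.3 (1.28)),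
* the germ Gaussian space `germSpace = ⨅ n, H(I n)` (Rozanov's `H₊(S) = ⋂_ε H(S^ε)`, Ch. 2 §3.3).

The main result of this file, `indicatorConstLp_mem_germExpSpan`, is the `L²` form of the
classical identity *"`⋂_ε σ(H(S^ε)) = σ(⋂_ε H(S^ε))` modulo null sets"* for Gaussian fields
(used tacitly throughout Rozanov 1982, Ch. 2 §3 — "for Gaussian fields the Markov property of the
σ-algebras `𝒜(S)` generated by `H(S)` is the splitting of the spaces `H(S)`" — and in Janson 1997,
Ch. 4, via second quantisation): the indicator of every germ event lies in the closed linear span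
`germExpSpan` of the characters `e^{iη}`, `η ∈ H₊`.  Proof (conditional characteristic functions,
no chaos decomposition): if `h ⊥ germExpSpan` is a.e. measurable for every `σ(X_{I n})`, then for
each `n` and test vector `v`, `X v = Pₙ(X v) + Rₙ` with `Pₙ` the projection onto `H(I n)` and `Rₙ`
INDEPENDENT of `σ(X_{I n})` (`indep_comap_of_forall_inner_eq_zero`), so
`⟪h, e^{iXv}⟫ = ⟪h, e^{iPₙXv}⟫ · E[e^{iRₙ}]`; as `n → ∞`, `Pₙ X v → P_∞ X v ∈ H₊` (von Neumann,
`starProjection_tendsto_iInf`), whence `⟪h, e^{iXv}⟫ = 0` for all `v`, and `h = 0` by the totality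
of characters (`ae_eq_zero_of_forall_integral_cexp_mul_eq_zero`).

## References

* Yu. A. Rozanov, *Markov Random Fields*, Springer 1982, Ch. 2 §1.3 (1.28), §3.1 (3.3), §3.3.
  [Rozanov1982]
* S. Janson, *Gaussian Hilbert Spaces*, CUP 1997, Ch. 1 and Ch. 4 (conditioning = second
  quantisation of a projection). [Janson1997]
-/

noncomputable section

open MeasureTheory ProbabilityTheory Filter Complex
open scoped ENNReal InnerProductSpace Topology ComplexConjugate

namespace Literature.Probability.Process

namespace IsGaussianLinearProcess

variable {Ω : Type*} {m₀ : MeasurableSpace Ω} {μ : Measure Ω}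
variable {V : Type*} [AddCommGroup V] [Module ℝ V]
variable {X : V →ₗ[ℝ] Ω → ℝ} (h : IsGaussianLinearProcess X μ)
include h

/-! ### Characters `e^{iz}` as elements of `L²(μ; ℂ)` -/

/-- `ω ↦ e^{i z(ω)}` is in `L²` for a.e.-strongly measurable real `z` (bounded by one).
[folklore] -/
theorem memLp_cexp {z : Ω → ℝ} (hz : AEStronglyMeasurable z μ) :
    MemLp (fun ω => cexp (z ω * I)) 2 μ := by
  haveI := h.isProbabilityMeasure
  exact MemLp.of_bound (by fun_prop) 1 (ae_of_all _ fun ω => by rw [norm_exp_ofReal_mul_I])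

/-- The character `e^{iz} ∈ L²(μ; ℂ)` of an a.e.-strongly measurable real function `z`. [folklore] -/
def expI {z : Ω → ℝ} (hz : AEStronglyMeasurable z μ) : Lp ℂ 2 μ := (h.memLp_cexp hz).toLp _

/-- `expI z = e^{iz}` almost everywhere. [folklore] -/
theorem coeFn_expI {z : Ω → ℝ} (hz : AEStronglyMeasurable z μ) :
    (h.expI hz : Ω → ℂ) =ᵐ[μ] fun ω => cexp (z ω * I) := (h.memLp_cexp hz).coeFn_toLp

/-- `expI` only depends on the a.e. class of `z`. [folklore] -/
theorem expI_congr {z z' : Ω → ℝ} (hz : AEStronglyMeasurable z μ) (hz' : AEStronglyMeasurable z' μ)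
    (hzz' : z =ᵐ[μ] z') : h.expI hz = h.expI hz' := by
  refine MemLp.toLp_congr _ _ ?_
  filter_upwards [hzz'] with ω hω
  rw [hω]

/-- `z ↦ e^{iz}` is `1`-Lipschitz from `L²(μ; ℝ)` to `L²(μ; ℂ)`. [folklore] -/
theorem norm_expI_sub_expI_le (z z' : Lp ℝ 2 μ) :
    ‖h.expI (Lp.aestronglyMeasurable z) - h.expI (Lp.aestronglyMeasurable z')‖ ≤ ‖z - z'‖ := by
  refine Lp.norm_le_norm_of_ae_le ?_
  filter_upwards [Lp.coeFn_sub (h.expI (Lp.aestronglyMeasurable z)) (h.expI (Lp.aestronglyMeasurable z')),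
    Lp.coeFn_sub z z', h.coeFn_expI (Lp.aestronglyMeasurable z),
    h.coeFn_expI (Lp.aestronglyMeasurable z')] with ω h1 h2 h3 h4
  rw [h1, Pi.sub_apply, h3, h4, h2, Pi.sub_apply, Real.norm_eq_abs]
  exact Literature.Probability.Distributions.norm_cexp_mul_I_sub_cexp_mul_I_le _ _

/-- `L²`-convergence of real functions gives `L²`-convergence of their characters. [folklore] -/
theorem tendsto_expI {z : ℕ → Lp ℝ 2 μ} {z₀ : Lp ℝ 2 μ} (hz : Tendsto z atTop (𝓝 z₀)) :
    Tendsto (fun n => h.expI (Lp.aestronglyMeasurable (z n))) atTop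
      (𝓝 (h.expI (Lp.aestronglyMeasurable z₀))) := by
  rw [tendsto_iff_norm_sub_tendsto_zero] at hz ⊢
  exact squeeze_zero (fun n => norm_nonneg _) (fun n => h.norm_expI_sub_expI_le _ _) hz

/-- `⟪g, e^{iz}⟫_{L²(ℂ)} = ∫ conj(g) e^{iz} dμ`. [folklore] -/
theorem inner_expI (g : Lp ℂ 2 μ) {z : Ω → ℝ} (hz : AEStronglyMeasurable z μ) :
    ⟪g, h.expI hz⟫_ℂ = ∫ ω, conj (g ω) * cexp (z ω * I) ∂μ := by
  rw [MeasureTheory.L2.inner_def]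
  refine integral_congr_ae ?_
  filter_upwards [h.coeFn_expI hz] with ω hω
  rw [hω, RCLike.inner_apply, mul_comm]

/-! ### Germ σ-algebra, germ space, germ characters -/

section Germ

variable (S : ℕ → Submodule ℝ V)

/-- The **germ Gaussian space** `H₊ = ⨅ n, H(S n)` of a sequence of submodules of test vectors
(Rozanov's `H₊(S) = ⋂_ε H(S^ε)`, Ch. 2 §3.3). [cite: Rozanov1982, Ch. 2 §3.3] -/
def germSpace : Submodule ℝ (Lp ℝ 2 μ) := ⨅ n, h.space (S n)

/-- The germ space is contained in each `H(S n)`. [folklore] -/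
theorem germSpace_le (n : ℕ) : h.germSpace S ≤ h.space (S n) := iInf_le _ n

/-- The germ space has an orthogonal projection. [folklore] -/
instance hasOrthogonalProjection_germSpace : (h.germSpace S).HasOrthogonalProjection :=
  Literature.Analysis.InnerProduct.hasOrthogonalProjection_iInf _

/-- The **germ characters**: the closed complex-linear span in `L²(μ; ℂ)` of `{e^{iη} : η ∈ H₊}`.
[folklore] -/
def germExpSpan : Submodule ℂ (Lp ℂ 2 μ) :=
  (Submodule.span ℂ (Set.range fun y : h.germSpace S =>
    h.expI (Lp.aestronglyMeasurable (y : Lp ℝ 2 μ)))).topologicalClosure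

/-- `germExpSpan` is closed, hence complete and with an orthogonal projection. [folklore] -/
instance completeSpace_germExpSpan : CompleteSpace (h.germExpSpan S) :=
  (Submodule.isClosed_topologicalClosure _).completeSpace_coe

/-- `e^{iη} ∈ germExpSpan` for `η ∈ H₊`. [folklore] -/
theorem expI_mem_germExpSpan {y : Lp ℝ 2 μ} (hy : y ∈ h.germSpace S) :
    h.expI (Lp.aestronglyMeasurable y) ∈ h.germExpSpan S :=
  (Submodule.le_topologicalClosure _) (Submodule.subset_span ⟨⟨y, hy⟩, rfl⟩)

/-- Every germ character is a.e. measurable for each `σ(X v : v ∈ S n)`. [folklore] -/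
theorem aestronglyMeasurable_of_mem_germExpSpan (n : ℕ) {g : Lp ℂ 2 μ}
    (hg : g ∈ h.germExpSpan S) :
    AEStronglyMeasurable[IsGaussianLinearProcess.sigma (X := X) (S n)] g μ := by
  have hm : IsGaussianLinearProcess.sigma (X := X) (S n) ≤ m₀ := sigma_le h.measurable (S n)
  have hle : Submodule.span ℂ (Set.range fun y : h.germSpace S =>
      h.expI (Lp.aestronglyMeasurable (y : Lp ℝ 2 μ))) ≤
      lpMeas ℂ ℂ (IsGaussianLinearProcess.sigma (X := X) (S n)) 2 μ := by
    refine Submodule.span_le.2 ?_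
    rintro _ ⟨y, rfl⟩
    rw [SetLike.mem_coe, mem_lpMeas_iff_aestronglyMeasurable]
    have hy : AEStronglyMeasurable[IsGaussianLinearProcess.sigma (X := X) (S n)]
        ((y : Lp ℝ 2 μ) : Ω → ℝ) μ :=
      h.aestronglyMeasurable_of_mem_space (h.germSpace_le S n y.2)
    have hexp : AEStronglyMeasurable[IsGaussianLinearProcess.sigma (X := X) (S n)]
        (fun ω => cexp (((y : Lp ℝ 2 μ) : Ω → ℝ) ω * I)) μ :=
      Complex.continuous_exp.comp_aestronglyMeasurable
        ((Complex.continuous_ofReal.comp_aestronglyMeasurable hy).mul_const I)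
    exact hexp.congr (h.coeFn_expI _).symm
  exact mem_lpMeas_iff_aestronglyMeasurable.1
    (Submodule.topologicalClosure_minimal _ hle (isClosed_aestronglyMeasurable hm) hg)

/-! ### The core computation: characters are orthogonal to germ-measurable residuals -/

/-- **Core step.**  If `g ∈ L²(μ; ℂ)` is orthogonal to all germ characters and a.e. measurable for
every `σ(X v : v ∈ S n)`, then `⟪g, e^{i X v}⟫ = 0` for every test vector `v`: decompose
`X v = Pₙ X v + Rₙ` with `Rₙ ⊥ H(S n)`, hence independent of `σ(X_{S n})`, so that
`⟪g, e^{iXv}⟫ = ⟪g, e^{iPₙXv}⟫ · E[e^{iRₙ}]`, and let `n → ∞` (`Pₙ X v → P_∞ X v ∈ H₊`).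
[cite: Rozanov1982, Ch. 2 §3.1 (3.3)] -/
theorem inner_expI_eq_zero_of_mem_orthogonal (hS : Antitone S) {g : Lp ℂ 2 μ}
    (hg : g ∈ (h.germExpSpan S)ᗮ)
    (hgm : ∀ n, AEStronglyMeasurable[IsGaussianLinearProcess.sigma (X := X) (S n)] g μ) (v : V) :
    ⟪g, h.expI (h.measurable v).aestronglyMeasurable⟫_ℂ = 0 := by
  haveI := h.isProbabilityMeasure
  set Jv := h.toL2 v with hJv
  have hanti : Antitone fun n => h.space (S n) := fun m n hmn => h.space_mono (hS hmn)
  set y : ℕ → Lp ℝ 2 μ := fun n => (h.space (S n)).starProjection Jv with hy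
  have hy_mem : ∀ n, y n ∈ h.space (S n) := fun n => Submodule.starProjection_apply_mem _ _
  have hR_orth : ∀ n, Jv - y n ∈ (h.space (S n))ᗮ := fun n =>
    Submodule.sub_starProjection_mem_orthogonal _
  -- (b) factorisation through the independent residual `Rₙ = Jv - yₙ`
  have hfac : ∀ n, ⟪g, h.expI (h.measurable v).aestronglyMeasurable⟫_ℂ =
      ⟪g, h.expI (Lp.aestronglyMeasurable (y n))⟫_ℂ *
        ∫ ω, cexp (((Jv - y n : Lp ℝ 2 μ) : Ω → ℝ) ω * I) ∂μ := by
    intro n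
    have hRtop : Jv - y n ∈ h.space ⊤ :=
      Submodule.sub_mem _ (h.toL2_mem_space trivial) (h.space_mono le_top (hy_mem n))
    have hRorth : ∀ w ∈ S n, ⟪Jv - y n, h.toL2 w⟫_ℝ = 0 := fun w hw =>
      Submodule.inner_left_of_mem_orthogonal (h.toL2_mem_space hw) (hR_orth n)
    have hind := h.indep_comap_of_forall_inner_eq_zero (S n) hRtop hRorth
    obtain ⟨g', hg'm, hgg'⟩ := hgm n
    obtain ⟨y', hy'm, hyy'⟩ := h.aestronglyMeasurable_of_mem_space (hy_mem n)
    set F : Ω → ℂ := fun ω => conj (g' ω) * cexp (y' ω * I) with hF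
    set G : Ω → ℂ := fun ω => cexp (((Jv - y n : Lp ℝ 2 μ) : Ω → ℝ) ω * I) with hG
    have hFm : Measurable[IsGaussianLinearProcess.sigma (X := X) (S n)] F :=
      (Complex.continuous_conj.measurable.comp hg'm.measurable).mul
        (Complex.measurable_exp.comp ((Complex.measurable_ofReal.comp hy'm.measurable).mul_const I))
    have hGm : Measurable[MeasurableSpace.comap ((Jv - y n : Lp ℝ 2 μ) : Ω → ℝ)
        (inferInstance : MeasurableSpace ℝ)] G :=
      Complex.measurable_exp.comp ((Complex.measurable_ofReal.comp
        (comap_measurable ((Jv - y n : Lp ℝ 2 μ) : Ω → ℝ))).mul_const I)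
    have hFG : IndepFun F G μ := by
      rw [IndepFun_iff_Indep]
      exact indep_of_indep_of_le_right (indep_of_indep_of_le_left hind.symm hFm.comap_le)
        hGm.comap_le
    have hFm₀ : AEStronglyMeasurable F μ :=
      (hFm.mono (sigma_le h.measurable (S n)) le_rfl).aestronglyMeasurable
    have hGm₀ : AEStronglyMeasurable G μ := by
      simp only [hG]
      fun_prop
    have hint := hFG.integral_fun_mul_eq_mul_integral hFm₀ hGm₀
    have hXv : ∀ᵐ ω ∂μ, X v ω = ((Jv - y n : Lp ℝ 2 μ) : Ω → ℝ) ω + y' ω := by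
      filter_upwards [h.coeFn_toL2 v, Lp.coeFn_sub Jv (y n), hyy'] with ω h1 h2 h3
      rw [h2, Pi.sub_apply, ← h3, ← h1, sub_add_cancel]
    calc ⟪g, h.expI (h.measurable v).aestronglyMeasurable⟫_ℂ
        = ∫ ω, conj (g ω) * cexp (X v ω * I) ∂μ := h.inner_expI g _
      _ = ∫ ω, F ω * G ω ∂μ := by
          refine integral_congr_ae ?_
          filter_upwards [hXv, hgg'] with ω h1 h2
          simp only [hF, hG]
          rw [h1, h2, Complex.ofReal_add, add_mul, Complex.exp_add]
          ring
      _ = (∫ ω, F ω ∂μ) * ∫ ω, G ω ∂μ := hint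
      _ = ⟪g, h.expI (Lp.aestronglyMeasurable (y n))⟫_ℂ *
            ∫ ω, cexp (((Jv - y n : Lp ℝ 2 μ) : Ω → ℝ) ω * I) ∂μ := by
          congr 1
          rw [h.inner_expI]
          refine integral_congr_ae ?_
          filter_upwards [hgg', hyy'] with ω h1 h2
          simp only [hF]
          rw [h1, h2]
  -- (c) the right factor has norm at most one
  have hbound : ∀ n, ‖⟪g, h.expI (h.measurable v).aestronglyMeasurable⟫_ℂ‖ ≤
      ‖⟪g, h.expI (Lp.aestronglyMeasurable (y n))⟫_ℂ‖ := fun n => by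
    rw [hfac n, norm_mul]
    refine mul_le_of_le_one_right (norm_nonneg _) ?_
    refine (norm_integral_le_of_norm_le_const (C := 1) (ae_of_all _ fun ω => ?_)).trans ?_
    · rw [norm_exp_ofReal_mul_I]
    · simp
  -- (d) the left factor tends to zero: `yₙ → y_∞ ∈ H₊` and `g ⊥ e^{i y_∞}`
  have hlim : Tendsto (fun n => ⟪g, h.expI (Lp.aestronglyMeasurable (y n))⟫_ℂ) atTop (𝓝 0) := by
    haveI : (⨅ n, h.space (S n)).HasOrthogonalProjection := h.hasOrthogonalProjection_germSpace S
    have hyt : Tendsto y atTop (𝓝 ((⨅ n, h.space (S n)).starProjection Jv)) :=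
      Literature.Analysis.InnerProduct.starProjection_tendsto_iInf (fun n => h.space (S n)) hanti Jv
    have hinner := Filter.Tendsto.inner (𝕜 := ℂ) (tendsto_const_nhds (x := g)) (h.tendsto_expI hyt)
    have hmem : (⨅ n, h.space (S n)).starProjection Jv ∈ h.germSpace S :=
      Submodule.starProjection_apply_mem _ _
    have hzero : ⟪g, h.expI (Lp.aestronglyMeasurable
        ((⨅ n, h.space (S n)).starProjection Jv))⟫_ℂ = 0 :=
      Submodule.inner_left_of_mem_orthogonal (h.expI_mem_germExpSpan S hmem) hg
    rwa [hzero] at hinner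
  have h0 : Tendsto (fun _ : ℕ => ‖⟪g, h.expI (h.measurable v).aestronglyMeasurable⟫_ℂ‖) atTop
      (𝓝 0) :=
    squeeze_zero (fun _ => norm_nonneg _) hbound (by simpa using hlim.norm)
  exact norm_eq_zero.1 (tendsto_nhds_unique tendsto_const_nhds h0)

/-- **`L²` of the germ σ-algebra is spanned by the germ characters** (the `L²` form of
`⋂ₙ σ(H(Sₙ)) = σ(⋂ₙ H(Sₙ))` mod null sets for Gaussian spaces): the indicator of every event of the
germ σ-algebra `⨅ n, σ(X v : v ∈ S n)` belongs to the closed span of `{e^{iη} : η ∈ H₊}`.  Proof: the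
residual of the indicator after projecting onto `germExpSpan` is orthogonal to all characters
`e^{iXv}` (`inner_expI_eq_zero_of_mem_orthogonal`), hence zero by totality
(`ae_eq_zero_of_forall_integral_cexp_mul_eq_zero`). [cite: Rozanov1982, Ch. 2 §3.1 and §3.3] -/
theorem indicatorConstLp_mem_germExpSpan (hS : Antitone S) {A : Set Ω}
    (hA : MeasurableSet[⨅ n, IsGaussianLinearProcess.sigma (X := X) (S n)] A)
    (hAm : MeasurableSet A) (hμA : μ A ≠ ∞) :
    indicatorConstLp 2 hAm hμA (1 : ℂ) ∈ h.germExpSpan S := by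
  haveI := h.isProbabilityMeasure
  set K := h.germExpSpan S with hK
  set one : Lp ℂ 2 μ := indicatorConstLp 2 hAm hμA (1 : ℂ) with hone
  set g : Lp ℂ 2 μ := one - K.starProjection one with hgdef
  have hg : g ∈ Kᗮ := Submodule.sub_starProjection_mem_orthogonal one
  have hgm : ∀ n, AEStronglyMeasurable[IsGaussianLinearProcess.sigma (X := X) (S n)] g μ := by
    intro n
    have hAn : MeasurableSet[IsGaussianLinearProcess.sigma (X := X) (S n)] A :=
      (iInf_le (fun n => IsGaussianLinearProcess.sigma (X := X) (S n)) n) A hA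
    have h1 : AEStronglyMeasurable[IsGaussianLinearProcess.sigma (X := X) (S n)] one μ :=
      ((stronglyMeasurable_const (b := (1 : ℂ))).indicator hAn).aestronglyMeasurable.congr
        indicatorConstLp_coeFn.symm
    have h2 := h.aestronglyMeasurable_of_mem_germExpSpan S n (Submodule.starProjection_apply_mem K one)
    exact (h1.sub h2).congr (Lp.coeFn_sub _ _).symm
  have horth : ∀ v, ⟪g, h.expI (h.measurable v).aestronglyMeasurable⟫_ℂ = 0 := fun v =>
    h.inner_expI_eq_zero_of_mem_orthogonal S hS hg hgm v
  -- totality of the characters on `σ(X v : v ∈ S 0)` forces `g = 0`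
  have hg0 : g = 0 := by
    rw [Lp.eq_zero_iff_ae_eq_zero]
    let X₀ : (S 0) →ₗ[ℝ] Ω → ℝ := X.comp (S 0).subtype
    have hX₀ : ∀ w, Measurable (X₀ w) := fun w => h.measurable _
    have hcg : (fun ω => conj (g ω)) =ᵐ[μ] 0 := by
      refine ae_eq_zero_of_forall_integral_cexp_mul_eq_zero X₀ hX₀
        ((ContinuousLinearEquiv.integrable_comp_iff Complex.conjCLE).2
          ((Lp.memLp g).integrable one_le_two))
        (Complex.continuous_conj.comp_aestronglyMeasurable (hgm 0)) fun w => ?_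
      have hw := horth (w : V)
      rw [h.inner_expI] at hw
      rw [← hw]
      refine integral_congr_ae (ae_of_all _ fun ω => ?_)
      simp only []
      rw [mul_comm]
      rfl
    filter_upwards [hcg] with ω hω
    simpa using hω
  have hone' : one = K.starProjection one := sub_eq_zero.1 hg0
  rw [hone']
  exact Submodule.starProjection_apply_mem K one

end Germ

end IsGaussianLinearProcess

end Literature.Probability.Process
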